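import Literature.AnabelianGeometry.EtaleTheta.Discharge.Sec2Cor219iiiAssembly
import Literature.AnabelianGeometry.EtaleTheta.Discharge.Sec2Cor219iiiCoboundaryTransport
import HarnessLib

/-!
# [EtTh] Cor. 2.19 (iii), tower form (`ThetaEnvTower.Cor219_iii`, F-0650) — part 2e (GENERIC): the ⊇ half of the
# level-wise clause from the SAME heart, and the level-wise EQUALITY «γ^*Θ_M = Θ_M · (c ∘ aug)» (roadmap G8b; proof-only)

S. Mochizuki, *The étale theta function and its Frobenioid-theoretic manifestations*, Publ. RIMS **45** (2009)
[EtTh], §2, Cor. 2.19 (iii), PRIMS PDF p. 65 ("an arbitrary automorphism of `Π^tp_X` preserves this collection of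
classes … up to … some multiple"); Def. 2.13 p. 47 ("conjugation by an element of `μ_N` corresponds precisely to
modifying a cocycle by a coboundary"; "replacing `η̲̈^{Θ,l·ℤ×μ₂}` by an `O^×_K`-multiple … an `O^×_K`-conjugate")
[cite: MochizukiEtTh2009, Cor 2.19(iii) p.65].

Cell `abc-iut`, seat abc-iut-C-hgal-2 (gen 6), K-L6 row «COR219III-G8b» (abc-iut-L6-lead §F v1.19bw (1)), file 2 of the
row; sequel of abc-iut-w4-d038's part 2c `Sec2Cor219iiiAssembly` (p474712, `pullback_image_subset_of_heart`) and of
file 1 `Sec2Cor219iiiCoboundaryTransport` (HCOB both ways under no `l`-torsion).  PROOF-ONLY: no definition, no instance,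
no notation, no new named fact; abc-iut-L2-t8's `rootCocycles_rel` / `cobAt` / `conjRoot` / `exists_rootCocycle_conj`,
abc-iut-L2-t2's `ThetaEnvTower.conjCocycle` / `pullbackCocycle` and the part-2 toolkit (`exists_transport`,
`transport_conj`, `conjCocycle_conjCocycle`, `envCocycle_conj`, `rootCocycle_mul_cobAt_mem`) consumed BY NAME.

WHAT IS SHOWN (`T := C.thetaEnvTower τ hC hS`, level `M`; `γ` bi-continuous with `γ(Π^tp_Ÿ̲̲) = Π^tp_Ÿ̲̲`,
`γ(θ⁻¹(l·Δ_Θ)) = θ⁻¹(l·Δ_Θ)`; `γ̃` induced; `γ̄_M` admitted; HEART as in part 2c: the transport of ONE root cocycle `f₀`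
reduces mod `M` to `Inn(x)(red_M ∘ f₀) · (c ∘ aug)` with `x ∈ Π^tp_X̲̲` and a `G_K`-cocycle `c`):
* `modN_eq_conjCocycle_mul_red` — `red_M(conjRoot σ f₀ · ∂d) = Inn(σ)(red_M ∘ f₀) · red_M(∂d)` pointwise;
* **`subset_pullback_image_of_heart` (G8b, ⊇)** — under HEART and HCOB′ (coboundary transport ONTO),
  `Θ_M · (c ∘ aug) ⊆ γ^*Θ_M`: the preimage of `red_M(conjRoot σ f₀ · ∂d″) · (c∘aug)` is `red_M(conjRoot (γ(σx⁻¹)) f₀ · ∂d)`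
  with `γ̃⁻¹ ∘ ∂d ∘ γ = ∂(d″ a⁻¹)`, `red_M(a) = c(aug(σx⁻¹))` — the crossed-homomorphism identity `envCocycle_conj` produces
  exactly the `μ_M`-coboundary of `c(aug(σx⁻¹))`, which `∂(a⁻¹)` cancels.  NO heart for `γ⁻¹` and NO consistency
  coboundary are needed (the roadmap's caveat «G8b» is resolved this way);
* `pullback_image_eq_of_heart` (HEART + HCOB + HCOB′) and **`pullback_image_eq_of_heart_of_noTorsion`** (HEART + no
  `l`-torsion ALONE): the level-`M` clause `γ^*Θ_M = Θ_M · (c ∘ aug)` of `ThetaEnvTower.Cor219_iii`.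

HONEST FRAMING: unconditional statements about OUR typed objects over an arbitrary §1 setting; nothing of [EtTh] (refereed)
is asserted beyond what is proved; no side is taken on [IUTchIII] Cor. 3.12; typed ≠ proved; nothing asserts abc proved or
refuted.
-/

noncomputable section

namespace Literature.AnabelianGeometry.EtaleTheta

open Literature.AnabelianGeometry.SemiGraphs
open scoped IsMulCommutative

namespace ThetaSetting.EtaleThetaData.DoubleUnderline

variable {p : ℕ} [Fact p.Prime] {D : ThetaSetting p} {E : D.EtaleThetaData} {l : ℕ}
  (C : E.DoubleUnderline l) {Es : Set ℕ+} (τ : D.CyclotomeTower l Es)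

/-! ## §1. G8b: the ⊇ half of the level-wise clause of `ThetaEnvTower.Cor219_iii`, from the SAME heart -/

/-- The reduction mod `M` of a root cocycle written as `conjRoot σ f₀ · ∂d` (abc-iut-L2-t8's `rootCocycles_rel`) is
`Inn(σ)(red_M ∘ f₀) · red_M(∂d)` pointwise (`(l·Δ_Θ) ↠ μ_M` is a `G_K`-equivariant homomorphism).
[cite: MochizukiEtTh2009, Def 2.13 p.47] -/
theorem modN_eq_conjCocycle_mul_red (hC : D.Compat) (hS : D.Sec2Hyps) (M : Es)
    (f₀ f : contCocycles D.toTheta D.DeltaTheta C.GtpYdduu) (hf₀ : f₀ ∈ C.rootCocycles hC)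
    (hf : f ∈ C.rootCocycles hC) (σ : (C.thetaEnvTower τ hC hS).PiX) (d : D.DeltaTheta)
    (hrel : ∀ k : C.GtpYdduu,
      f.1 k = C.conjRoot hC σ f₀.1 k * (MulAut.conjNormal (D.toTheta (k : D.PiTemp)) d * d⁻¹))
    (g : (C.thetaEnvTower τ hC hS).PiYdd) :
    C.modN (τ.mod M) f hf.1 g =
      (C.thetaEnvTower τ hC hS).conjCocycle M σ (C.modN (τ.mod M) f₀ hf₀.1) g *
        (τ.mod M).red ⟨cobAt d (D.toTheta ((C.inclYdduu g : C.GtpYdduu) : D.PiTemp)), cobAt_mem hC hf₀ hf hrel _⟩ := by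
  have hσmem : σ⁻¹ * (g : (C.thetaEnvTower τ hC hS).PiX) * σ ∈ (C.thetaEnvTower τ hC hS).PiYdd := by
    simpa [mul_assoc] using (C.thetaEnvTower τ hC hS).PiYdd_normal.conj_mem _ g.2 σ⁻¹
  change (τ.mod M).red ⟨(f.1 (C.inclYdduu g) : D.GtpTheta), hf.1 _⟩ = _
  have hmul : (⟨(f.1 (C.inclYdduu g) : D.GtpTheta), hf.1 (C.inclYdduu g)⟩ : D.lDeltaTheta l) =
      ⟨(C.conjRoot hC σ f₀.1 (C.inclYdduu g) : D.GtpTheta), (D.lDeltaTheta_normal l).conj_mem _ (hf₀.1 _) _⟩ *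
        ⟨cobAt d (D.toTheta ((C.inclYdduu g : C.GtpYdduu) : D.PiTemp)), cobAt_mem hC hf₀ hf hrel _⟩ := by
    apply Subtype.ext
    change ((f.1 (C.inclYdduu g) : D.DeltaTheta) : D.GtpTheta) =
      (C.conjRoot hC σ f₀.1 (C.inclYdduu g) : D.GtpTheta) *
        (cobAt d (D.toTheta ((C.inclYdduu g : C.GtpYdduu) : D.PiTemp)) : D.GtpTheta)
    rw [hrel, Subgroup.coe_mul]
    rfl
  rw [hmul, map_mul]
  congr 1
  change _ = galMuN p M (D.aug.toMonoidHom ((σ : (C.thetaEnvTower τ hC hS).PiX) : D.PiTemp))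
    ((τ.mod M).red ⟨(f₀.1 (C.inclYdduu ⟨_, hσmem⟩) : D.GtpTheta), hf₀.1 _⟩)
  rw [← (τ.mod M).red_conj]
  congr 1

/-- **G8b (⊇ half): the level-wise assembly from the heart, converse inclusion.** Same situation as
`pullback_image_subset_of_heart` (abc-iut-w4-d038, part 2c): `γ` bi-continuous with `γ(Π^tp_Ÿ̲̲) = Π^tp_Ÿ̲̲`,
`γ(θ⁻¹(l·Δ_Θ)) = θ⁻¹(l·Δ_Θ)`, `γ̃` induced, `γ̄_M` admitted, and (HEART) the transport of ONE root cocycle `f₀` reduces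
mod `M` to `Inn(x)(red_M ∘ f₀) · (c ∘ aug)`.  If (HCOB′) the coboundary transport along `γ` is ONTO — every `d' ∈ Δ_Θ`
with `l·Δ_Θ`-valued coboundary on `Π^tp_Ÿ̲̲` is `γ̃⁻¹ ∘ ∂d ∘ γ` for some such `d` (a theorem under no `l`-torsion,
`cobAt_transport_surjective_of_noTorsion`) — THEN the collection multiplied by `c ∘ aug` is CONTAINED in the pulled-back
collection: the preimage of `red_M(conjRoot σ f₀ · ∂d″) · (c∘aug)` is `red_M(conjRoot (γ(σx⁻¹)) f₀ · ∂d)` where `∂d`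
transports to `∂(d″·a⁻¹)`, `red_M(a) = c(aug(σx⁻¹))` (the crossed-homomorphism identity `envCocycle_conj` produces
exactly the `μ_M`-coboundary of `c(aug(σx⁻¹))`, which `∂(a⁻¹)` cancels).  No heart for `γ⁻¹` is used.
[cite: MochizukiEtTh2009, Cor 2.19(iii) p.65] -/
theorem subset_pullback_image_of_heart (hC : D.Compat) (hS : D.Sec2Hyps) (M : Es)
    (γ : (C.thetaEnvTower τ hC hS).PiX ≃ₜ* (C.thetaEnvTower τ hC hS).PiX)
    (hγ : (C.thetaEnvTower τ hC hS).PiYdd.map γ.toMulEquiv.toMonoidHom = (C.thetaEnvTower τ hC hS).PiYdd)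
    (hL : (C.thetaEnvTower τ hC hS).lDeltaTheta.map γ.toMulEquiv.toMonoidHom = (C.thetaEnvTower τ hC hS).lDeltaTheta)
    (γΛ : D.lDeltaTheta l ≃* D.lDeltaTheta l)
    (hγΛ : ∀ (g : (C.thetaEnvTower τ hC hS).lDeltaTheta) (hg : γ g ∈ (C.thetaEnvTower τ hC hS).lDeltaTheta),
      C.toLDelta ⟨γ g, hg⟩ = γΛ (C.toLDelta g))
    (γμ : (C.thetaEnvTower τ hC hS).mu M ≃* (C.thetaEnvTower τ hC hS).mu M)
    (hcompat : ∀ (g : (C.thetaEnvTower τ hC hS).lDeltaTheta) (hg : γ g ∈ (C.thetaEnvTower τ hC hS).lDeltaTheta),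
      (C.thetaEnvTower τ hC hS).thetaMod M ⟨γ g, hg⟩ = γμ ((C.thetaEnvTower τ hC hS).thetaMod M g))
    (f₀ : contCocycles D.toTheta D.DeltaTheta C.GtpYdduu) (hf₀ : f₀ ∈ C.rootCocycles hC)
    (x : (C.thetaEnvTower τ hC hS).PiX) (c : (C.thetaEnvTower τ hC hS).G → (C.thetaEnvTower τ hC hS).mu M)
    (hc : CycEnvelope.IsEnvCocycle (MonoidHom.id (C.thetaEnvTower τ hC hS).G) ((C.thetaEnvTower τ hC hS).chi M) c)
    (heart : ∀ g : (C.thetaEnvTower τ hC hS).PiYdd,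
      (τ.mod M).red (γΛ.symm ⟨(f₀.1 (C.inclYdduu ⟨γ g, C.apply_mem_PiYdd τ hC hS γ hγ g⟩) : D.GtpTheta), hf₀.1 _⟩) =
        (C.thetaEnvTower τ hC hS).conjCocycle M x (C.modN (τ.mod M) f₀ hf₀.1) g *
          c ((C.thetaEnvTower τ hC hS).aug (g : (C.thetaEnvTower τ hC hS).PiX)))
    (hcob' : ∀ d' : D.DeltaTheta,
      (∀ k : C.GtpYdduu, (cobAt d' (D.toTheta (k : D.PiTemp)) : D.GtpTheta) ∈ D.lDeltaTheta l) →
      ∃ d : D.DeltaTheta,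
        (∀ k : C.GtpYdduu, (cobAt d (D.toTheta (k : D.PiTemp)) : D.GtpTheta) ∈ D.lDeltaTheta l) ∧
        ∀ g : (C.thetaEnvTower τ hC hS).PiYdd,
          ∃ hmem : (cobAt d (D.toTheta ((C.inclYdduu ⟨γ g, C.apply_mem_PiYdd τ hC hS γ hγ g⟩ : C.GtpYdduu) :
            D.PiTemp)) : D.GtpTheta) ∈ D.lDeltaTheta l,
          (γΛ.symm ⟨_, hmem⟩ : D.GtpTheta) =
            (cobAt d' (D.toTheta ((C.inclYdduu g : C.GtpYdduu) : D.PiTemp)) : D.GtpTheta)) :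
    (fun η => η * (c ∘ (C.thetaEnvTower τ hC hS).aug ∘ (C.thetaEnvTower τ hC hS).PiYdd.subtype)) ''
        (C.thetaEnvTower τ hC hS).thetaCocycles M ⊆
      (C.thetaEnvTower τ hC hS).pullbackCocycle M γ hγ γμ '' (C.thetaEnvTower τ hC hS).thetaCocycles M := by
  rintro _ ⟨η, hη, rfl⟩
  obtain ⟨f, hf, rfl⟩ := hη
  -- `f = conjRoot σ f₀ · ∂d″`
  obtain ⟨σ, d'', hrel⟩ := C.rootCocycles_rel hC hf₀ hf
  have hd''Λ : ∀ k : C.GtpYdduu, (cobAt d'' (D.toTheta (k : D.PiTemp)) : D.GtpTheta) ∈ D.lDeltaTheta l :=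
    fun k => cobAt_mem hC hf₀ hf hrel k
  -- `τ' := γ(σ x⁻¹)`, so that `γ⁻¹τ' · x = σ`; `a ∈ l·Δ_Θ` with `red_M a = c(aug(γ⁻¹ τ'))`
  set τ' : (C.thetaEnvTower τ hC hS).PiX := γ (σ * x⁻¹) with hτ'
  have hyx : γ.symm τ' * x = σ := by
    rw [hτ', ContinuousMulEquiv.symm_apply_apply, inv_mul_cancel_right]
  obtain ⟨a, ha⟩ := (τ.mod M).red_surjective (c ((C.thetaEnvTower τ hC hS).aug (γ.symm τ')))
  have haΔ : (a : D.GtpTheta) ∈ D.DeltaTheta := D.lDeltaTheta_le l a.2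
  -- `d' := d″ · a⁻¹`, whose coboundary is again `l·Δ_Θ`-valued on `Π^tp_Ÿ̲̲`
  have hd'Λ : ∀ k : C.GtpYdduu,
      (cobAt (d'' * (⟨(a : D.GtpTheta), haΔ⟩ : D.DeltaTheta)⁻¹) (D.toTheta (k : D.PiTemp)) : D.GtpTheta) ∈
        D.lDeltaTheta l := by
    intro k
    rw [cobAt_mul_left, Subgroup.coe_mul]
    refine mul_mem (hd''Λ k) ?_
    rw [coe_cobAt, Subgroup.coe_inv, inv_inv]
    exact mul_mem ((D.lDeltaTheta_normal l).conj_mem _ (inv_mem a.2) _) a.2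
  obtain ⟨d, hdΛ, hd⟩ := hcob' _ hd'Λ
  -- the root cocycles `f₁ := conjRoot τ' f₀`, `f₂ := f₁ · ∂d`, and the transports of `f₀`, `f₁`, `f₂`
  obtain ⟨f₁, hf₁, hf₁val⟩ := C.exists_rootCocycle_conj hC τ' f₀ hf₀
  set f₂ : contCocycles D.toTheta D.DeltaTheta C.GtpYdduu :=
    f₁ * ⟨fun k : C.GtpYdduu => cobAt d (D.toTheta (k : D.PiTemp)), coboundary_mem_contCocycles (D := D) d C.GtpYdduu⟩
    with hf₂def
  have hf₂ : f₂ ∈ C.rootCocycles hC := C.rootCocycle_mul_cobAt_mem hC f₁ hf₁ d hdΛ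
  obtain ⟨F₀, hF₀a, -, -⟩ := C.exists_transport τ hC hS γ hγ hL γΛ hγΛ f₀ hf₀.1
  obtain ⟨F₁, hF₁a, -, -⟩ := C.exists_transport τ hC hS γ hγ hL γΛ hγΛ f₁ hf₁.1
  obtain ⟨F₂, hF₂a, -, hF₂red⟩ := C.exists_transport τ hC hS γ hγ hL γΛ hγΛ f₂ hf₂.1
  -- the witness: `red_M ∘ Φ_γ(f₂)`
  refine ⟨C.modN (τ.mod M) f₂ hf₂.1, ⟨f₂, hf₂, rfl⟩, ?_⟩
  rw [hF₂red M γμ hcompat]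
  funext g
  have hyx_mem : ∀ g : (C.thetaEnvTower τ hC hS).PiYdd,
      (γ.symm τ')⁻¹ * (g : (C.thetaEnvTower τ hC hS).PiX) * γ.symm τ' ∈ (C.thetaEnvTower τ hC hS).PiYdd := fun g => by
    simpa [mul_assoc] using (C.thetaEnvTower τ hC hS).PiYdd_normal.conj_mem _ g.2 (γ.symm τ')⁻¹
  -- LEFT: `F₂ (incl g) = F₁ (incl g) · ∂(d″ a⁻¹)(θ g)`
  have hsplit : F₂ (C.inclYdduu g) =
      F₁ (C.inclYdduu g) *
        ⟨cobAt (d'' * (⟨(a : D.GtpTheta), haΔ⟩ : D.DeltaTheta)⁻¹)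
          (D.toTheta ((C.inclYdduu g : C.GtpYdduu) : D.PiTemp)), hd'Λ _⟩ := by
    rw [hF₂a, hF₁a]
    obtain ⟨hmem, hdg⟩ := hd g
    have hprod : (⟨(f₂.1 (C.inclYdduu ⟨γ g, C.apply_mem_PiYdd τ hC hS γ hγ g⟩) : D.GtpTheta), hf₂.1 _⟩ :
        D.lDeltaTheta l) =
        ⟨(f₁.1 (C.inclYdduu ⟨γ g, C.apply_mem_PiYdd τ hC hS γ hγ g⟩) : D.GtpTheta), hf₁.1 _⟩ * ⟨_, hmem⟩ := by
      apply Subtype.ext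
      change (((f₁.1 (C.inclYdduu ⟨γ g, C.apply_mem_PiYdd τ hC hS γ hγ g⟩) *
          cobAt d (D.toTheta ((C.inclYdduu ⟨γ g, C.apply_mem_PiYdd τ hC hS γ hγ g⟩ : C.GtpYdduu) : D.PiTemp))) :
            D.DeltaTheta) : D.GtpTheta) = _
      rw [Subgroup.coe_mul, Subgroup.coe_mul]
    rw [hprod, map_mul]
    congr 1
    exact Subtype.ext hdg
  -- LEFT: `red (F₁ (incl g)) = χ(aug y) · red (F₀ (incl (y⁻¹ g y)))`, `y = γ⁻¹ τ'`
  have hF₁red : (τ.mod M).red (F₁ (C.inclYdduu g)) =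
      galMuN p M (D.aug.toMonoidHom ((γ.symm τ' : (C.thetaEnvTower τ hC hS).PiX) : D.PiTemp))
        ((τ.mod M).red (F₀ (C.inclYdduu ⟨_, hyx_mem g⟩))) := by
    rw [← (τ.mod M).red_conj]
    congr 1
    apply Subtype.ext
    exact C.transport_conj τ hC hS γ hγ hL γΛ hγΛ f₀ f₁ hf₀.1 hf₁.1 τ' hf₁val F₀ F₁ hF₀a hF₁a g (hyx_mem g)
  have hheart := heart ⟨_, hyx_mem g⟩
  rw [hF₀a] at hF₁red
  -- RIGHT: `modN f g = Inn(σ)(modN f₀) g · red ∂d″(θ g)`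
  have hfval := C.modN_eq_conjCocycle_mul_red τ hC hS M f₀ f hf₀ hf σ d'' hrel g
  -- `red ∂(d″ a⁻¹)(θ g) = (∂_{μ_M} c(aug y))(g) · red ∂d″(θ g)`
  have hcobred : (τ.mod M).red ⟨cobAt (d'' * (⟨(a : D.GtpTheta), haΔ⟩ : D.DeltaTheta)⁻¹)
        (D.toTheta ((C.inclYdduu g : C.GtpYdduu) : D.PiTemp)), hd'Λ _⟩ =
      (τ.mod M).red ⟨cobAt d'' (D.toTheta ((C.inclYdduu g : C.GtpYdduu) : D.PiTemp)), cobAt_mem hC hf₀ hf hrel _⟩ *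
        ((galMuN p M (D.aug.toMonoidHom ((g : (C.thetaEnvTower τ hC hS).PiX) : D.PiTemp))
            (c ((C.thetaEnvTower τ hC hS).aug (γ.symm τ'))))⁻¹ *
          c ((C.thetaEnvTower τ hC hS).aug (γ.symm τ'))) := by
    have hsplit' : (⟨(cobAt (d'' * (⟨(a : D.GtpTheta), haΔ⟩ : D.DeltaTheta)⁻¹)
          (D.toTheta ((C.inclYdduu g : C.GtpYdduu) : D.PiTemp)) : D.GtpTheta), hd'Λ _⟩ : D.lDeltaTheta l) =
        ⟨(cobAt d'' (D.toTheta ((C.inclYdduu g : C.GtpYdduu) : D.PiTemp)) : D.GtpTheta),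
            cobAt_mem hC hf₀ hf hrel _⟩ *
          ((⟨D.toTheta ((C.inclYdduu g : C.GtpYdduu) : D.PiTemp) * (a : D.GtpTheta) *
              (D.toTheta ((C.inclYdduu g : C.GtpYdduu) : D.PiTemp))⁻¹, (D.lDeltaTheta_normal l).conj_mem _ a.2 _⟩)⁻¹ *
            a) := by
      apply Subtype.ext
      change (cobAt (d'' * (⟨(a : D.GtpTheta), haΔ⟩ : D.DeltaTheta)⁻¹)
          (D.toTheta ((C.inclYdduu g : C.GtpYdduu) : D.PiTemp)) : D.GtpTheta) =
        (cobAt d'' (D.toTheta ((C.inclYdduu g : C.GtpYdduu) : D.PiTemp)) : D.GtpTheta) *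
          ((D.toTheta ((C.inclYdduu g : C.GtpYdduu) : D.PiTemp) * (a : D.GtpTheta) *
              (D.toTheta ((C.inclYdduu g : C.GtpYdduu) : D.PiTemp))⁻¹)⁻¹ * (a : D.GtpTheta))
      rw [cobAt_mul_left, Subgroup.coe_mul, coe_cobAt (⟨(a : D.GtpTheta), haΔ⟩ : D.DeltaTheta)⁻¹]
      change (cobAt d'' (D.toTheta ((C.inclYdduu g : C.GtpYdduu) : D.PiTemp)) : D.GtpTheta) *
          (D.toTheta ((C.inclYdduu g : C.GtpYdduu) : D.PiTemp) * ((a : D.GtpTheta))⁻¹ *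
            (D.toTheta ((C.inclYdduu g : C.GtpYdduu) : D.PiTemp))⁻¹ * ((a : D.GtpTheta))⁻¹⁻¹) = _
      rw [inv_inv, mul_inv_rev, mul_inv_rev, inv_inv]
      simp only [mul_assoc]
    rw [hsplit', map_mul, map_mul, map_inv, (τ.mod M).red_conj, ha]
    rfl
  -- bookkeeping identities (as in part 2c)
  have hconj : (C.thetaEnvTower τ hC hS).conjCocycle M (γ.symm τ')
      ((C.thetaEnvTower τ hC hS).conjCocycle M x (C.modN (τ.mod M) f₀ hf₀.1)) g =
      galMuN p M (D.aug.toMonoidHom ((γ.symm τ' : (C.thetaEnvTower τ hC hS).PiX) : D.PiTemp))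
        ((C.thetaEnvTower τ hC hS).conjCocycle M x (C.modN (τ.mod M) f₀ hf₀.1) ⟨_, hyx_mem g⟩) := rfl
  have haug : (C.thetaEnvTower τ hC hS).aug ((⟨_, hyx_mem g⟩ : (C.thetaEnvTower τ hC hS).PiYdd) :
      (C.thetaEnvTower τ hC hS).PiX) =
      ((C.thetaEnvTower τ hC hS).aug (γ.symm τ'))⁻¹ *
        ((C.thetaEnvTower τ hC hS).aug (g : (C.thetaEnvTower τ hC hS).PiX) * (C.thetaEnvTower τ hC hS).aug (γ.symm τ')) := by
    apply eq_inv_mul_of_mul_eq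
    rw [← map_mul, ← map_mul]
    congr 1
    change γ.symm τ' * ((γ.symm τ')⁻¹ * (g : (C.thetaEnvTower τ hC hS).PiX) * γ.symm τ') = _
    group
  have hcc : galMuN p M (D.aug.toMonoidHom ((γ.symm τ' : (C.thetaEnvTower τ hC hS).PiX) : D.PiTemp))
      (c ((C.thetaEnvTower τ hC hS).aug ((⟨_, hyx_mem g⟩ : (C.thetaEnvTower τ hC hS).PiYdd) :
        (C.thetaEnvTower τ hC hS).PiX))) =
      c ((C.thetaEnvTower τ hC hS).aug (g : (C.thetaEnvTower τ hC hS).PiX)) *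
        (galMuN p M (D.aug.toMonoidHom ((g : (C.thetaEnvTower τ hC hS).PiX) : D.PiTemp))
            (c ((C.thetaEnvTower τ hC hS).aug (γ.symm τ'))) *
          (c ((C.thetaEnvTower τ hC hS).aug (γ.symm τ')))⁻¹) := by
    rw [haug, ← mul_assoc]
    exact envCocycle_conj ((C.thetaEnvTower τ hC hS).chi M) c hc ((C.thetaEnvTower τ hC hS).aug (γ.symm τ'))
      ((C.thetaEnvTower τ hC hS).aug (g : (C.thetaEnvTower τ hC hS).PiX))
  -- assemble
  simp only [Pi.mul_apply, Function.comp_apply, Subgroup.coe_subtype]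
  rw [hsplit, map_mul, hF₁red, hheart, map_mul, ← hconj, C.conjCocycle_conjCocycle τ hC hS M x (γ.symm τ'), hyx, hcc,
    hcobred, hfval]
  apply (Additive.ofMul : (C.thetaEnvTower τ hC hS).mu M ≃ Additive ((C.thetaEnvTower τ hC hS).mu M)).injective
  simp only [ofMul_mul, ofMul_inv]
  abel

/-- **The level-`M` clause of `ThetaEnvTower.Cor219_iii` from the heart (both inclusions).** Under HEART, HCOB and HCOB′
the pulled-back mod-`M` theta collection EQUALS the collection multiplied by `c ∘ aug` (part 2c's
`pullback_image_subset_of_heart` and `subset_pullback_image_of_heart`). [cite: MochizukiEtTh2009, Cor 2.19(iii) p.65] -/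
theorem pullback_image_eq_of_heart (hC : D.Compat) (hS : D.Sec2Hyps) (M : Es)
    (γ : (C.thetaEnvTower τ hC hS).PiX ≃ₜ* (C.thetaEnvTower τ hC hS).PiX)
    (hγ : (C.thetaEnvTower τ hC hS).PiYdd.map γ.toMulEquiv.toMonoidHom = (C.thetaEnvTower τ hC hS).PiYdd)
    (hL : (C.thetaEnvTower τ hC hS).lDeltaTheta.map γ.toMulEquiv.toMonoidHom = (C.thetaEnvTower τ hC hS).lDeltaTheta)
    (γΛ : D.lDeltaTheta l ≃* D.lDeltaTheta l)
    (hγΛ : ∀ (g : (C.thetaEnvTower τ hC hS).lDeltaTheta) (hg : γ g ∈ (C.thetaEnvTower τ hC hS).lDeltaTheta),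
      C.toLDelta ⟨γ g, hg⟩ = γΛ (C.toLDelta g))
    (γμ : (C.thetaEnvTower τ hC hS).mu M ≃* (C.thetaEnvTower τ hC hS).mu M)
    (hcompat : ∀ (g : (C.thetaEnvTower τ hC hS).lDeltaTheta) (hg : γ g ∈ (C.thetaEnvTower τ hC hS).lDeltaTheta),
      (C.thetaEnvTower τ hC hS).thetaMod M ⟨γ g, hg⟩ = γμ ((C.thetaEnvTower τ hC hS).thetaMod M g))
    (f₀ : contCocycles D.toTheta D.DeltaTheta C.GtpYdduu) (hf₀ : f₀ ∈ C.rootCocycles hC)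
    (x : (C.thetaEnvTower τ hC hS).PiX) (c : (C.thetaEnvTower τ hC hS).G → (C.thetaEnvTower τ hC hS).mu M)
    (hc : CycEnvelope.IsEnvCocycle (MonoidHom.id (C.thetaEnvTower τ hC hS).G) ((C.thetaEnvTower τ hC hS).chi M) c)
    (heart : ∀ g : (C.thetaEnvTower τ hC hS).PiYdd,
      (τ.mod M).red (γΛ.symm ⟨(f₀.1 (C.inclYdduu ⟨γ g, C.apply_mem_PiYdd τ hC hS γ hγ g⟩) : D.GtpTheta), hf₀.1 _⟩) =
        (C.thetaEnvTower τ hC hS).conjCocycle M x (C.modN (τ.mod M) f₀ hf₀.1) g *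
          c ((C.thetaEnvTower τ hC hS).aug (g : (C.thetaEnvTower τ hC hS).PiX)))
    (hcob : ∀ d : D.DeltaTheta,
      (∀ k : C.GtpYdduu, (cobAt d (D.toTheta (k : D.PiTemp)) : D.GtpTheta) ∈ D.lDeltaTheta l) →
      ∃ d' : D.DeltaTheta, ∀ (g : (C.thetaEnvTower τ hC hS).PiYdd)
        (hmem : (cobAt d (D.toTheta ((C.inclYdduu ⟨γ g, C.apply_mem_PiYdd τ hC hS γ hγ g⟩ : C.GtpYdduu) :
          D.PiTemp)) : D.GtpTheta) ∈ D.lDeltaTheta l),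
        (γΛ.symm ⟨_, hmem⟩ : D.GtpTheta) = (cobAt d' (D.toTheta ((C.inclYdduu g : C.GtpYdduu) : D.PiTemp)) : D.GtpTheta))
    (hcob' : ∀ d' : D.DeltaTheta,
      (∀ k : C.GtpYdduu, (cobAt d' (D.toTheta (k : D.PiTemp)) : D.GtpTheta) ∈ D.lDeltaTheta l) →
      ∃ d : D.DeltaTheta,
        (∀ k : C.GtpYdduu, (cobAt d (D.toTheta (k : D.PiTemp)) : D.GtpTheta) ∈ D.lDeltaTheta l) ∧
        ∀ g : (C.thetaEnvTower τ hC hS).PiYdd,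
          ∃ hmem : (cobAt d (D.toTheta ((C.inclYdduu ⟨γ g, C.apply_mem_PiYdd τ hC hS γ hγ g⟩ : C.GtpYdduu) :
            D.PiTemp)) : D.GtpTheta) ∈ D.lDeltaTheta l,
          (γΛ.symm ⟨_, hmem⟩ : D.GtpTheta) =
            (cobAt d' (D.toTheta ((C.inclYdduu g : C.GtpYdduu) : D.PiTemp)) : D.GtpTheta)) :
    (C.thetaEnvTower τ hC hS).pullbackCocycle M γ hγ γμ '' (C.thetaEnvTower τ hC hS).thetaCocycles M =
      (fun η => η * (c ∘ (C.thetaEnvTower τ hC hS).aug ∘ (C.thetaEnvTower τ hC hS).PiYdd.subtype)) ''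
        (C.thetaEnvTower τ hC hS).thetaCocycles M :=
  Set.Subset.antisymm
    (C.pullback_image_subset_of_heart τ hC hS M γ hγ hL γΛ hγΛ γμ hcompat f₀ hf₀ x c hc heart hcob)
    (C.subset_pullback_image_of_heart τ hC hS M γ hγ hL γΛ hγΛ γμ hcompat f₀ hf₀ x c hc heart hcob')

/-- **The level-`M` clause of `ThetaEnvTower.Cor219_iii` from the heart ALONE, over any §1 setting whose `Δ_Θ` has no
`l`-torsion** (HCOB, HCOB′ discharged by file 1, `Sec2Cor219iiiCoboundaryTransport`): `γ^*Θ_M = Θ_M · (c ∘ aug)`. [cite: MochizukiEtTh2009, Cor 2.19(iii) p.65] -/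
theorem pullback_image_eq_of_heart_of_noTorsion (hC : D.Compat) (hS : D.Sec2Hyps)
    (hT : ∀ t : D.DeltaTheta, t ^ l = 1 → t = 1) (M : Es)
    (γ : (C.thetaEnvTower τ hC hS).PiX ≃ₜ* (C.thetaEnvTower τ hC hS).PiX)
    (hγ : (C.thetaEnvTower τ hC hS).PiYdd.map γ.toMulEquiv.toMonoidHom = (C.thetaEnvTower τ hC hS).PiYdd)
    (hL : (C.thetaEnvTower τ hC hS).lDeltaTheta.map γ.toMulEquiv.toMonoidHom = (C.thetaEnvTower τ hC hS).lDeltaTheta)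
    (γΛ : D.lDeltaTheta l ≃* D.lDeltaTheta l)
    (hγΛ : ∀ (g : (C.thetaEnvTower τ hC hS).lDeltaTheta) (hg : γ g ∈ (C.thetaEnvTower τ hC hS).lDeltaTheta),
      C.toLDelta ⟨γ g, hg⟩ = γΛ (C.toLDelta g))
    (γμ : (C.thetaEnvTower τ hC hS).mu M ≃* (C.thetaEnvTower τ hC hS).mu M)
    (hcompat : ∀ (g : (C.thetaEnvTower τ hC hS).lDeltaTheta) (hg : γ g ∈ (C.thetaEnvTower τ hC hS).lDeltaTheta),
      (C.thetaEnvTower τ hC hS).thetaMod M ⟨γ g, hg⟩ = γμ ((C.thetaEnvTower τ hC hS).thetaMod M g))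
    (f₀ : contCocycles D.toTheta D.DeltaTheta C.GtpYdduu) (hf₀ : f₀ ∈ C.rootCocycles hC)
    (x : (C.thetaEnvTower τ hC hS).PiX) (c : (C.thetaEnvTower τ hC hS).G → (C.thetaEnvTower τ hC hS).mu M)
    (hc : CycEnvelope.IsEnvCocycle (MonoidHom.id (C.thetaEnvTower τ hC hS).G) ((C.thetaEnvTower τ hC hS).chi M) c)
    (heart : ∀ g : (C.thetaEnvTower τ hC hS).PiYdd,
      (τ.mod M).red (γΛ.symm ⟨(f₀.1 (C.inclYdduu ⟨γ g, C.apply_mem_PiYdd τ hC hS γ hγ g⟩) : D.GtpTheta), hf₀.1 _⟩) =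
        (C.thetaEnvTower τ hC hS).conjCocycle M x (C.modN (τ.mod M) f₀ hf₀.1) g *
          c ((C.thetaEnvTower τ hC hS).aug (g : (C.thetaEnvTower τ hC hS).PiX))) :
    (C.thetaEnvTower τ hC hS).pullbackCocycle M γ hγ γμ '' (C.thetaEnvTower τ hC hS).thetaCocycles M =
      (fun η => η * (c ∘ (C.thetaEnvTower τ hC hS).aug ∘ (C.thetaEnvTower τ hC hS).PiYdd.subtype)) ''
        (C.thetaEnvTower τ hC hS).thetaCocycles M :=
  C.pullback_image_eq_of_heart τ hC hS M γ hγ hL γΛ hγΛ γμ hcompat f₀ hf₀ x c hc heart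
    (fun d _ => C.transport_cobAt_of_noTorsion τ hC hS hT γ hγ hL γΛ hγΛ d)
    (fun d' hd' => C.cobAt_transport_surjective_of_noTorsion τ hC hS hT γ hγ hL γΛ hγΛ d' hd')

end ThetaSetting.EtaleThetaData.DoubleUnderline

end Literature.AnabelianGeometry.EtaleTheta

end
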